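import Mathlib
import Literature.Geometry.Symplectic.JHolomorphicMap
import Literature.Analysis.Complex.Hurwitz
import Literature.Analysis.Complex.InjectiveHolomorphic
import Summits.SmoothPoincare4.SmoothPoincare4.Theorems.SullivanDualTameOrBrodyR4StubConfineQ

/-!
# Stub `stub_limitCrossings` of line `Sketch` for crux `TameOrBrodyR4` (stmt-SmoothPoincare4-7826, route SullivanDual)

Far crossings of a `C⁰_loc`-limit of pencil members, by Hurwitz's theorem. Setting:
`ℝ⁴ = EuclideanSpace ℝ (Fin 4)`, a real-linear coordinate `P : ℝ⁴ →L[ℝ] ℂ` with `|P x| ≤ ‖x‖`, and a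
family `J x : ℝ⁴ →L[ℝ] ℝ⁴` which is standard in the `P`-direction where `‖x‖ ≥ R`
(`P (J x v) = i P v`). Entire `C^∞` flat-`J`-holomorphic maps `u n : ℂ → ℝ⁴` cross every far line
`{P = c}`, `|c| > 2R`, exactly once (`h7`) and with bijective differential of `P ∘ u n` wherever
`|P ∘ u n| > 2R` (`h8`); they converge locally uniformly to an entire `C^∞` flat-`J`-holomorphic `v`
with `P (v ξ) - ξ → 0` at infinity (`h6`). We prove that `v` crosses every far line at most once
and that the real differential of `P ∘ v` is bijective wherever `|P ∘ v| > 2R`.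

How (namespace `LimitCrossings`).
* `differentiableAt_coord`: the coordinate `P ∘ w` of a flat-`J`-holomorphic `w` is complex
  differentiable at every `ξ` with `R ≤ ‖w ξ‖` (its real derivative `P ∘ dw(ξ)` commutes with `i`;
  `ConfineQ.differentiableAt_of_fderiv_mul_I`).
* `bijective_fderiv_iff`: for `q : ℂ → ℂ` complex differentiable at `ξ`, the real differential
  `ζ ↦ ζ · q'(ξ)` is bijective iff `q'(ξ) ≠ 0`.
* `not_eventually_eq_const`: a continuous `h : ℂ → ℂ`, holomorphic on an open set containing the
  level set `{h = c}`, with `h ξ - ξ → 0` at infinity, is nowhere locally constant equal to `c`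
  (the set where it is so is clopen by the identity theorem; if it were all of `ℂ` then
  `‖h ξ - ξ‖ = ‖c - ξ‖ → ∞`).
* `eventually_exists_crossing`: if `P (v ξ₀) = c`, `|c| > 2R`, then for every `ρ > 0` there is
  `0 < r ≤ ρ` such that eventually `P ∘ u n` takes the value `c` in `ball ξ₀ r` — Hurwitz's theorem
  in the one-disc form `Complex.eventually_exists_zero_mem_ball_of_tendstoUniformlyOn` applied to
  `P ∘ u n - c → P ∘ v - c` on a small closed disc on which `‖v‖ > 2R` (so `‖u n‖ > R` eventually and
  all maps are holomorphic) and on whose boundary `P ∘ v ≠ c` (isolated zeros, by the previous item).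
* `stub_limitCrossings`: two crossings `ξ₁ ≠ ξ₂` of `{P = c}` by `v` would give, for large `n`, two
  crossings of `u n` in disjoint discs, contradicting `h7`; and if `(P ∘ v)'(ξ₀) = 0` with
  `|P (v ξ₀)| > 2R`, Hurwitz's theorem for the derivatives `(P ∘ u n)' → (P ∘ v)'`
  (`TendstoLocallyUniformlyOn.deriv`, `Complex.hurwitz_eqOn_zero_or_forall_ne_zero`; the
  `(P ∘ u n)'` are zero-free near `ξ₀` by `h8`) forces `(P ∘ v)' ≡ 0` near `ξ₀`, i.e. `P ∘ v` locally
  constant, contradicting `not_eventually_eq_const`.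

Sources: A. Hurwitz, Math. Ann. 33 (1889), 246–266; J. B. Conway, *Functions of One Complex
Variable I*, 2nd ed. (1978), Ch. VII, Thm. 2.5 and Cor. 2.6 (Hurwitz's theorem); M. Gromov, Invent.
Math. 82 (1985), §2.4.A (pencils of `J`-planes standard at infinity). No `J`-curve theory beyond the
definition is used.
-/

-- the registered namespace `Summit.SmoothPoincare4.SmoothPoincare4.…` repeats a component
set_option linter.dupNamespace false

noncomputable section

open scoped ContDiff Topology
open Filter Set Metric Literature.Geometry.Symplectic

namespace Summit.SmoothPoincare4.SmoothPoincare4.Cruxes.TameOrBrodyR4.Sketch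

local notation "E4" => EuclideanSpace ℝ (Fin 4)

namespace LimitCrossings

/-- **Holomorphy of the far coordinate.** For a real-differentiable flat-`J`-holomorphic
`w : ℂ → ℝ⁴` and `P ∘ J_x = i P` where `‖x‖ ≥ R`: the coordinate `P ∘ w` is complex differentiable
at every `ξ` with `R ≤ ‖w ξ‖` (its real derivative `P ∘ dw(ξ)` commutes with `i`). -/
theorem differentiableAt_coord {J : E4 → E4 →L[ℝ] E4} {R : ℝ} {P : E4 →L[ℝ] ℂ}
    (hJP : ∀ x : E4, R ≤ ‖x‖ → ∀ v, P (J x v) = Complex.I * P v) {w : ℂ → E4}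
    (hw : Differentiable ℝ w) (hwJ : IsJHolomorphicFlat J w) {ξ : ℂ} (hξ : R ≤ ‖w ξ‖) :
    DifferentiableAt ℂ (fun ξ => P (w ξ)) ξ := by
  have hqd : HasFDerivAt (fun ξ => P (w ξ)) (P.comp (fderiv ℝ w ξ)) ξ :=
    P.hasFDerivAt.comp ξ (hw ξ).hasFDerivAt
  refine ConfineQ.differentiableAt_of_fderiv_mul_I hqd.differentiableAt fun ζ => ?_
  rw [hqd.fderiv, ContinuousLinearMap.comp_apply, ContinuousLinearMap.comp_apply, hwJ ξ ζ,
    hJP _ hξ]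

/-- **Real differential vs complex derivative.** For `q : ℂ → ℂ` complex differentiable at `ξ`,
the real differential `dq(ξ) = (ζ ↦ ζ · q'(ξ))` is bijective iff `q'(ξ) ≠ 0`. -/
theorem bijective_fderiv_iff {q : ℂ → ℂ} {ξ : ℂ} (hq : DifferentiableAt ℂ q ξ) :
    Function.Bijective (fderiv ℝ q ξ) ↔ deriv q ξ ≠ 0 := by
  have key : ∀ ζ : ℂ, fderiv ℝ q ξ ζ = ζ * deriv q ξ := fun ζ => by
    rw [hq.fderiv_restrictScalars ℝ, ContinuousLinearMap.coe_restrictScalars',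
      fderiv_eq_smul_deriv, smul_eq_mul]
  constructor
  · intro hb hd
    have h10 : fderiv ℝ q ξ 1 = fderiv ℝ q ξ 0 := by rw [key, key, hd, mul_zero, mul_zero]
    exact one_ne_zero (hb.1 h10)
  · intro hd
    refine ⟨fun ζ₁ ζ₂ h => ?_, fun w => ⟨w / deriv q ξ, ?_⟩⟩
    · rw [key, key] at h
      exact mul_right_cancel₀ hd h
    · rw [key]
      exact div_mul_cancel₀ w hd

/-- **No local constancy** (identity theorem + normalisation at infinity). Let `h : ℂ → ℂ` be
continuous, holomorphic on an open set `S` containing the level set `{h = c}`, with `h ξ - ξ → 0`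
at infinity. Then `h` is not eventually equal to `c` near any point: the set of points near which
`h ≡ c` is open, closed (a limit of such points lies in the level set, hence in `S`, and the identity
theorem on a small disc applies) and, if nonempty, all of `ℂ`; but `h ≡ c` contradicts
`‖h ξ - ξ‖ = ‖c - ξ‖ → ∞`. -/
theorem not_eventually_eq_const {h : ℂ → ℂ} {S : Set ℂ} (hc : Continuous h) (hS : IsOpen S)
    (hhol : DifferentiableOn ℂ h S) {c : ℂ} (hcS : ∀ ξ, h ξ = c → ξ ∈ S)
    (hlim : Tendsto (fun ξ => h ξ - ξ) (cocompact ℂ) (𝓝 0)) (ξ₀ : ℂ) :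
    ¬ ∀ᶠ η in 𝓝 ξ₀, h η = c := by
  intro hξ₀
  have han : AnalyticOnNhd ℂ h S := hhol.analyticOnNhd hS
  -- the set of points near which `h ≡ c` is clopen and nonempty, hence everything
  have hAopen : IsOpen {ξ : ℂ | ∀ᶠ η in 𝓝 ξ, h η = c} := isOpen_setOf_eventually_nhds
  have hAclosed : IsClosed {ξ : ℂ | ∀ᶠ η in 𝓝 ξ, h η = c} := by
    refine isClosed_of_closure_subset fun ξ hξ => ?_
    have hξc : h ξ = c := by
      have hsub : {ξ : ℂ | ∀ᶠ η in 𝓝 ξ, h η = c} ⊆ {η | h η = c} := fun η hη => hη.self_of_nhds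
      exact ((isClosed_eq hc continuous_const).closure_subset_iff.2 hsub) hξ
    obtain ⟨ε, hε, hball⟩ := Metric.isOpen_iff.1 hS ξ (hcS ξ hξc)
    obtain ⟨η, hηball, hηA⟩ := mem_closure_iff_nhds.1 hξ (ball ξ ε) (ball_mem_nhds ξ hε)
    have heq : EqOn h (fun _ => c) (ball ξ ε) :=
      (han.mono hball).eqOn_of_preconnected_of_eventuallyEq analyticOnNhd_const
        (convex_ball ξ ε).isPreconnected hηball hηA
    exact eventually_of_mem (ball_mem_nhds ξ hε) fun η hη => heq hη
  have hall : ∀ ξ, h ξ = c := fun ξ => by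
    have hξA : ξ ∈ {ξ : ℂ | ∀ᶠ η in 𝓝 ξ, h η = c} :=
      (IsClopen.eq_univ ⟨hAclosed, hAopen⟩ ⟨ξ₀, hξ₀⟩).symm ▸ mem_univ ξ
    exact hξA.self_of_nhds
  -- ... so `h ξ - ξ = c - ξ`, which does not tend to `0` at infinity
  have h1 : Tendsto (fun ξ : ℂ => ‖h ξ - ξ‖) (cocompact ℂ) (𝓝 0) :=
    (tendsto_zero_iff_norm_tendsto_zero).1 hlim
  have h2 : Tendsto (fun ξ : ℂ => ‖h ξ - ξ‖) (cocompact ℂ) atTop := by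
    refine tendsto_atTop_mono (fun ξ => ?_)
      (tendsto_atTop_add_const_right _ (-‖c‖) tendsto_norm_cocompact_atTop)
    show ‖ξ‖ + -‖c‖ ≤ ‖h ξ - ξ‖
    rw [hall ξ, norm_sub_rev]
    linarith [norm_sub_norm_le ξ c]
  exact not_tendsto_nhds_of_tendsto_atTop h2 0 h1

/-- **Uniform convergence of the coordinates.** If `u n → v` uniformly on `K` and `|P x| ≤ ‖x‖`,
then `P ∘ u n - c → P ∘ v - c` uniformly on `K`. -/
theorem tendstoUniformlyOn_coord {P : E4 →L[ℝ] ℂ} (hP : ∀ x : E4, ‖P x‖ ≤ ‖x‖) {u : ℕ → ℂ → E4}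
    {v : ℂ → E4} {K : Set ℂ} (hK : TendstoUniformlyOn u v atTop K) (c : ℂ) :
    TendstoUniformlyOn (fun n z => P (u n z) - c) (fun z => P (v z) - c) atTop K := by
  rw [Metric.tendstoUniformlyOn_iff] at hK ⊢
  intro ε hε
  filter_upwards [hK ε hε] with n hn z hz
  refine lt_of_le_of_lt ?_ (hn z hz)
  rw [dist_sub_right, dist_eq_norm, dist_eq_norm, ← map_sub]
  exact hP _

/-- **Persistence of crossings** (Hurwitz's theorem, one-disc form). In the setting of
`stub_limitCrossings`, if `P (v ξ₀) = c` with `|c| > 2R`, then for every `ρ > 0` there is a radius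
`0 < r ≤ ρ` such that, for all large `n`, `P ∘ u n` takes the value `c` in `ball ξ₀ r`: `ξ₀` is an
isolated point of the level set `{P ∘ v = c}` (`not_eventually_eq_const`), so on a small closed disc
around `ξ₀` we have `‖v‖ > 2R` (hence `‖u n‖ > R` eventually, and all of `P ∘ u n`, `P ∘ v` are
holomorphic there by `differentiableAt_coord`), `P ∘ v ≠ c` on the boundary circle, and
`P ∘ u n - c → P ∘ v - c` uniformly; `Complex.eventually_exists_zero_mem_ball_of_tendstoUniformlyOn`
gives the zero. -/
theorem eventually_exists_crossing {J : E4 → E4 →L[ℝ] E4} {R : ℝ} (hR : 0 < R) {P : E4 →L[ℝ] ℂ}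
    (hP : ∀ x : E4, ‖P x‖ ≤ ‖x‖)
    (hJP : ∀ x : E4, R ≤ ‖x‖ → ∀ v, P (J x v) = Complex.I * P v)
    {u : ℕ → ℂ → E4} {v : ℂ → E4} (hud : ∀ n, Differentiable ℝ (u n))
    (huJ : ∀ n, IsJHolomorphicFlat J (u n)) (hvd : Differentiable ℝ v)
    (hvJ : IsJHolomorphicFlat J v) (hloc : TendstoLocallyUniformly u v atTop)
    (h6 : Tendsto (fun ξ => P (v ξ) - ξ) (cocompact ℂ) (𝓝 0))
    {c : ℂ} (hc : 2 * R < ‖c‖) {ξ₀ : ℂ} (h0 : P (v ξ₀) = c) {ρ : ℝ} (hρ : 0 < ρ) :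
    ∃ r, 0 < r ∧ r ≤ ρ ∧ ∀ᶠ n in atTop, ∃ z ∈ ball ξ₀ r, P (u n z) = c := by
  -- `P ∘ v` is holomorphic on the open set `{R < ‖v‖}`, which contains the level set `{P ∘ v = c}`
  have hOopen : IsOpen {ξ : ℂ | R < ‖v ξ‖} := isOpen_lt continuous_const hvd.continuous.norm
  have hhol : DifferentiableOn ℂ (fun ξ => P (v ξ)) {ξ : ℂ | R < ‖v ξ‖} := fun ξ hξ =>
    (differentiableAt_coord hJP hvd hvJ (le_of_lt hξ)).differentiableWithinAt
  have hcont : Continuous fun ξ => P (v ξ) := P.continuous.comp hvd.continuous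
  have hcO : ∀ ξ, P (v ξ) = c → ξ ∈ {ξ : ℂ | R < ‖v ξ‖} := fun ξ hξ => by
    have h1 := hP (v ξ)
    rw [hξ] at h1
    show R < ‖v ξ‖
    linarith
  -- `ξ₀` is an isolated point of the level set
  have han : AnalyticAt ℂ (fun ξ => P (v ξ) - c) ξ₀ :=
    ((hhol.analyticOnNhd hOopen) ξ₀ (hcO ξ₀ h0)).sub analyticAt_const
  have hiso : ∀ᶠ z in 𝓝[≠] ξ₀, P (v z) - c ≠ 0 := by
    rcases han.eventually_eq_zero_or_eventually_ne_zero with h | h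
    · exact absurd (h.mono fun z hz => sub_eq_zero.1 hz)
        (not_eventually_eq_const hcont hOopen hhol hcO h6 ξ₀)
    · exact h
  have hv2R : ∀ᶠ z in 𝓝 ξ₀, 2 * R < ‖v z‖ := by
    refine (isOpen_lt continuous_const hvd.continuous.norm).mem_nhds ?_
    show 2 * R < ‖v ξ₀‖
    have h1 := hP (v ξ₀)
    rw [h0] at h1
    linarith
  have h' : ∀ᶠ z in 𝓝 ξ₀, (z ≠ ξ₀ → P (v z) - c ≠ 0) ∧ 2 * R < ‖v z‖ :=
    (eventually_nhdsWithin_iff.1 hiso).and hv2R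
  obtain ⟨r₀, hr₀, hball⟩ := Metric.eventually_nhds_iff_ball.1 h'
  -- the disc: radius `min (r₀ / 2) ρ`, its closure inside `ball ξ₀ r₀`
  have hrpos : 0 < min (r₀ / 2) ρ := lt_min (half_pos hr₀) hρ
  have hsub : closedBall ξ₀ (min (r₀ / 2) ρ) ⊆ ball ξ₀ r₀ :=
    closedBall_subset_ball (lt_of_le_of_lt (min_le_left _ _) (half_lt_self hr₀))
  refine ⟨min (r₀ / 2) ρ, hrpos, min_le_right _ _, ?_⟩
  have hK : TendstoUniformlyOn u v atTop (closedBall ξ₀ (min (r₀ / 2) ρ)) :=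
    (tendstoLocallyUniformly_iff_forall_isCompact.1 hloc) _ (isCompact_closedBall _ _)
  -- eventually `‖u n‖ ≥ R` on the closed disc, so `P ∘ u n - c` is holomorphic there
  have hF : ∀ᶠ n in atTop,
      DiffContOnCl ℂ (fun z => P (u n z) - c) (ball ξ₀ (min (r₀ / 2) ρ)) := by
    filter_upwards [(Metric.tendstoUniformlyOn_iff.1 hK) R hR] with n hn
    refine ⟨fun z hz => ?_,
      ((P.continuous.comp (hud n).continuous).sub continuous_const).continuousOn⟩
    have hzK : z ∈ closedBall ξ₀ (min (r₀ / 2) ρ) := ball_subset_closedBall hz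
    have h2 : 2 * R < ‖v z‖ := (hball z (hsub hzK)).2
    have hd : dist (v z) (u n z) < R := hn z hzK
    have hR' : R ≤ ‖u n z‖ := by
      rw [dist_eq_norm] at hd
      linarith [norm_sub_norm_le (v z) (u n z)]
    exact ((differentiableAt_coord hJP (hud n) (huJ n) hR').sub_const c).differentiableWithinAt
  have hsphere : ∀ z ∈ sphere ξ₀ (min (r₀ / 2) ρ), P (v z) - c ≠ 0 := by
    intro z hz
    refine (hball z (hsub (sphere_subset_closedBall hz))).1 ?_
    rintro rfl
    rw [mem_sphere, dist_self] at hz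
    exact hrpos.ne hz
  have hev := Complex.eventually_exists_zero_mem_ball_of_tendstoUniformlyOn hrpos hF
    (tendstoUniformlyOn_coord hP hK c) (hcont.sub continuous_const).continuousOn
    (show P (v ξ₀) - c = 0 by rw [h0, sub_self]) hsphere
  filter_upwards [hev] with n ⟨z, hz, hz0⟩
  exact ⟨z, hz, sub_eq_zero.1 hz0⟩

end LimitCrossings

/-- **Far crossings of the limit (Hurwitz).** Let `J` be standard in the `P`-direction on
`‖x‖ ≥ R` (`P ∘ J_x = i P`, `|P x| ≤ ‖x‖`, `0 < R`), let the entire `C^∞` flat-`J`-holomorphic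
`u n : ℂ → ℝ⁴` cross each far line `{P = c}`, `|c| > 2R`, exactly once and with bijective
differential of `P ∘ u n` wherever `|P ∘ u n| > 2R`, and let `u n → v` locally uniformly with `v`
entire `C^∞` flat-`J`-holomorphic and normalised (`P (v ξ) - ξ → 0` at infinity). Then `v` crosses
each far line at most once, and the differential of `P ∘ v` is bijective wherever `|P ∘ v| > 2R`.
Proof: `P ∘ v` is holomorphic where `‖v‖ > R` and nowhere locally constant at a far value
(`LimitCrossings.not_eventually_eq_const`); two distinct crossings of `{P = c}` by `v` would persist
as two distinct crossings of `u n` for large `n` (`LimitCrossings.eventually_exists_crossing`,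
Hurwitz), contradicting uniqueness; and a zero of `(P ∘ v)'` at a far point would, by Hurwitz's
theorem for the zero-free derivatives `(P ∘ u n)' → (P ∘ v)'`
(`Complex.hurwitz_eqOn_zero_or_forall_ne_zero`), force `(P ∘ v)' ≡ 0` nearby, i.e. `P ∘ v` locally
constant — impossible. -/
theorem stub_limitCrossings (J : E4 → E4 →L[ℝ] E4) (R : ℝ) (hR : 0 < R) (P : E4 →L[ℝ] ℂ)
    (hP : ∀ x : E4, ‖P x‖ ≤ ‖x‖)
    (hJP : ∀ x : E4, R ≤ ‖x‖ → ∀ v, P (J x v) = Complex.I * P v)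
    (u : ℕ → ℂ → E4) (v : ℂ → E4) (hu : ∀ n, ContDiff ℝ ∞ (u n))
    (huJ : ∀ n, IsJHolomorphicFlat J (u n)) (hv : ContDiff ℝ ∞ v) (hvJ : IsJHolomorphicFlat J v)
    (hloc : TendstoLocallyUniformly u v atTop)
    (h7 : ∀ n (c : ℂ), 2 * R < ‖c‖ → ∃! ξ, P (u n ξ) = c)
    (h8 : ∀ n (ξ : ℂ), 2 * R < ‖P (u n ξ)‖ →
      Function.Bijective (fderiv ℝ (fun ξ => P (u n ξ)) ξ))
    (h6 : Tendsto (fun ξ => P (v ξ) - ξ) (cocompact ℂ) (𝓝 0)) :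
    (∀ c : ℂ, 2 * R < ‖c‖ → ∀ ξ ξ' : ℂ, P (v ξ) = c → P (v ξ') = c → ξ = ξ') ∧
      (∀ ξ : ℂ, 2 * R < ‖P (v ξ)‖ → Function.Bijective (fderiv ℝ (fun ξ => P (v ξ)) ξ)) := by
  have hud : ∀ n, Differentiable ℝ (u n) := fun n => (hu n).differentiable (by simp)
  have hvd : Differentiable ℝ v := hv.differentiable (by simp)
  refine ⟨fun c hc ξ₁ ξ₂ h₁ h₂ => ?_, fun ξ₀ hξ₀ => ?_⟩
  · -- uniqueness of far crossings: two crossings of `v` persist as two crossings of `u n`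
    by_contra hne
    have hρ : 0 < dist ξ₁ ξ₂ / 2 := half_pos (dist_pos.2 hne)
    obtain ⟨r₁, -, hr₁, hev₁⟩ :=
      LimitCrossings.eventually_exists_crossing hR hP hJP hud huJ hvd hvJ hloc h6 hc h₁ hρ
    obtain ⟨r₂, -, hr₂, hev₂⟩ :=
      LimitCrossings.eventually_exists_crossing hR hP hJP hud huJ hvd hvJ hloc h6 hc h₂ hρ
    obtain ⟨n, ⟨z₁, hz₁, hz₁c⟩, ⟨z₂, hz₂, hz₂c⟩⟩ := (hev₁.and hev₂).exists
    have hzz : z₁ = z₂ := (h7 n c hc).unique hz₁c hz₂c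
    rw [mem_ball] at hz₁ hz₂
    rw [hzz] at hz₁
    linarith [dist_triangle_left ξ₁ ξ₂ z₂]
  · -- transversality of far crossings: Hurwitz for the derivatives
    have hOopen : IsOpen {ξ : ℂ | R < ‖v ξ‖} := isOpen_lt continuous_const hvd.continuous.norm
    have hhol : DifferentiableOn ℂ (fun ξ => P (v ξ)) {ξ : ℂ | R < ‖v ξ‖} := fun ξ hξ =>
      (LimitCrossings.differentiableAt_coord hJP hvd hvJ (le_of_lt hξ)).differentiableWithinAt
    have hcont : Continuous fun ξ => P (v ξ) := P.continuous.comp hvd.continuous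
    have hdiff₀ : DifferentiableAt ℂ (fun ξ => P (v ξ)) ξ₀ :=
      LimitCrossings.differentiableAt_coord hJP hvd hvJ (by linarith [hP (v ξ₀)])
    rw [LimitCrossings.bijective_fderiv_iff hdiff₀]
    intro hd0
    -- a closed disc around `ξ₀` on which `|P ∘ v| > 2R + m`
    obtain ⟨m, hmpos, hm⟩ : ∃ m : ℝ, 0 < m ∧ 2 * R + m < ‖P (v ξ₀)‖ :=
      ⟨(‖P (v ξ₀)‖ - 2 * R) / 2, by linarith, by linarith⟩
    have hev : ∀ᶠ z in 𝓝 ξ₀, 2 * R + m < ‖P (v z)‖ :=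
      (isOpen_lt continuous_const hcont.norm).mem_nhds hm
    obtain ⟨r₀, hr₀, hball⟩ := Metric.eventually_nhds_iff_ball.1 hev
    have hrpos : 0 < r₀ / 2 := half_pos hr₀
    have hsub : closedBall ξ₀ (r₀ / 2) ⊆ ball ξ₀ r₀ := closedBall_subset_ball (half_lt_self hr₀)
    have hK : TendstoUniformlyOn u v atTop (closedBall ξ₀ (r₀ / 2)) :=
      (tendstoLocallyUniformly_iff_forall_isCompact.1 hloc) _ (isCompact_closedBall _ _)
    -- eventually, on the closed disc: `P ∘ u n` is holomorphic with non-vanishing derivative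
    have hevn : ∀ᶠ n in atTop, ∀ z ∈ closedBall ξ₀ (r₀ / 2),
        DifferentiableAt ℂ (fun ξ => P (u n ξ)) z ∧ deriv (fun ξ => P (u n ξ)) z ≠ 0 := by
      filter_upwards [(Metric.tendstoUniformlyOn_iff.1 hK) (min R m) (lt_min hR hmpos)]
        with n hn z hz
      have h1 : 2 * R + m < ‖P (v z)‖ := hball z (hsub hz)
      have h2 : ‖P (v z)‖ ≤ ‖v z‖ := hP _
      have hd : dist (v z) (u n z) < min R m := hn z hz
      rw [dist_eq_norm] at hd
      have hdR : ‖v z - u n z‖ < R := lt_of_lt_of_le hd (min_le_left _ _)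
      have hdm : ‖v z - u n z‖ < m := lt_of_lt_of_le hd (min_le_right _ _)
      have hR' : R ≤ ‖u n z‖ := by linarith [norm_sub_norm_le (v z) (u n z)]
      have hdiff := LimitCrossings.differentiableAt_coord hJP (hud n) (huJ n) hR'
      have h2R : 2 * R < ‖P (u n z)‖ := by
        have e2 : ‖P (v z) - P (u n z)‖ ≤ ‖v z - u n z‖ := by rw [← map_sub]; exact hP _
        linarith [norm_sub_norm_le (P (v z)) (P (u n z))]
      exact ⟨hdiff, (LimitCrossings.bijective_fderiv_iff hdiff).1 (h8 n z h2R)⟩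
    have hFdiff : ∀ᶠ n in atTop, DifferentiableOn ℂ (fun ξ => P (u n ξ)) (ball ξ₀ (r₀ / 2)) := by
      filter_upwards [hevn] with n hn using
        fun z hz => (hn z (ball_subset_closedBall hz)).1.differentiableWithinAt
    have hlim : TendstoLocallyUniformlyOn (fun n ξ => P (u n ξ)) (fun ξ => P (v ξ)) atTop
        (ball ξ₀ (r₀ / 2)) := by
      have := LimitCrossings.tendstoUniformlyOn_coord hP hK 0
      simp only [sub_zero] at this
      exact (this.mono ball_subset_closedBall).tendstoLocallyUniformlyOn
    have hlim' : TendstoLocallyUniformlyOn (fun n => deriv fun ξ => P (u n ξ))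
        (deriv fun ξ => P (v ξ)) atTop (ball ξ₀ (r₀ / 2)) :=
      hlim.deriv hFdiff isOpen_ball
    have hF' : ∀ᶠ n in atTop,
        DifferentiableOn ℂ (deriv fun ξ => P (u n ξ)) (ball ξ₀ (r₀ / 2)) := by
      filter_upwards [hFdiff] with n hn using hn.deriv isOpen_ball
    have h0 : ∃ᶠ n in atTop, ∀ z ∈ ball ξ₀ (r₀ / 2), deriv (fun ξ => P (u n ξ)) z ≠ 0 :=
      (hevn.mono fun n hn z hz => (hn z (ball_subset_closedBall hz)).2).frequently
    rcases Complex.hurwitz_eqOn_zero_or_forall_ne_zero isOpen_ball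
        (convex_ball ξ₀ (r₀ / 2)).isPreconnected hF' hlim' h0 with hzero | hne
    · -- `(P ∘ v)' ≡ 0` on the disc: `P ∘ v` is constant there, contradicting non-constancy
      have hholU : DifferentiableOn ℂ (fun ξ => P (v ξ)) (ball ξ₀ (r₀ / 2)) :=
        hhol.mono fun z hz => by
          show R < ‖v z‖
          linarith [hball z (hsub (ball_subset_closedBall hz)), hP (v z)]
      have hconst : ∀ z ∈ ball ξ₀ (r₀ / 2), P (v z) = P (v ξ₀) := fun z hz =>
        isOpen_ball.is_const_of_deriv_eq_zero (convex_ball ξ₀ (r₀ / 2)).isPreconnected hholU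
          hzero hz (mem_ball_self hrpos)
      refine LimitCrossings.not_eventually_eq_const hcont hOopen hhol (c := P (v ξ₀))
        (fun ξ hξ => ?_) h6 ξ₀ (eventually_of_mem (ball_mem_nhds ξ₀ hrpos) hconst)
      show R < ‖v ξ‖
      have h1 := hP (v ξ)
      rw [hξ] at h1
      linarith
    · exact hne ξ₀ (mem_ball_self hrpos) hd0

end Summit.SmoothPoincare4.SmoothPoincare4.Cruxes.TameOrBrodyR4.Sketch
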